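import Literature.LinearAlgebra.QuadraticForm.PosComplexStructuresPolarizationKernelLevelStructure
import Mathlib.SetTheory.Cardinal.NatCard
import HarnessLib

/-!
# Horizontal sections of the kernel of the polarization: `H⁰(Γ\X⁺, Γ\(X⁺ × K(ψ))) ≃ K(ψ)^Γ`, at most
# `|det Ψ| = deg φ_L` of them, with equality iff `Γ` acts trivially on `K(ψ)` — the zero section, and
# a class extends to a horizontal section iff it is `Γ`-invariant

Topic `LinearAlgebra/QuadraticForm`; sequel of `QuadraticForm/PosComplexStructuresPolarizationKernelLocalSystem`
(`K(ψ) = V(ℤ)^∨/λ_ψ V(ℤ)`, its `Γ(1)`-action `cokernelMap`/`cokernelAction`, the kernel local system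
`PolarizationKernelSystem G hψΛ = Γ\(X⁺ × K(ψ))` with projection `polarizationKernelSystemProj`, `#K(ψ) =
|det Ψ|`: `natCard_dualQuotientRange_eq_natAbs_det`, `finite_dualQuotientRange`) and
`QuadraticForm/PosComplexStructuresPolarizationKernelLevelStructure` (over a level-`N` base all `|det Ψ|`
classes are horizontal), with the generic `Topology/CoveringSpaces/AssociatedCoveringSections`
(`continuousSectionEquivFixedPoints : H⁰(E ×_G S) ≃ S^G`, `exists_section_through_iff`, `flatSection`).

SOURCES (held, read at the page; VERBATIM). C. Voisin, *Hodge Theory and Complex Algebraic Geometry II*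
[VoisinHodgeII2003] §3.1.1 (held p0088–p0090): Cor. 3.10 and (3.1): the sections of the local system of a
representation over `U` are «`{σ : π⁻¹(U) → G ∣ σ(γ·u) = ρ(γ)·σ(u)}`», so the global sections are the
invariants of the monodromy; Prop. 3.9 (trivial representation ↔ constant local system). P. Deligne
(notes by J. S. Milne), *Hodge cycles on abelian varieties*, LNM 900 [Deligne1982HodgeCycles], proof of
Thm. 4.8, p. 50 (held p0034): «`Θ₁` the polarization with Riemann form `ψ`», «`k₁` is a level `n` structure»,
«`Γ` acts on `X⁺` … and (compatibly) on `B`». H. Lange [Lange2023AbelianVarietiesComplex] §1.4.2 (p0045)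
«`K(L) = Λ(L)/Λ` (1.14)», Prop. 1.4.7 «`deg φ_L = det(Im H)`».

## What is formalised (`Γ(1) = arithmeticGroup k ψ Λ`, `G ≤ Γ(1)` torsion-free (`htf`); `hψΛ : ψ(V(ℤ),
## V(ℤ)) ⊆ ℤ`; `hnd : ψ` non-degenerate; `b` a `ℤ`-basis of `V(ℤ)`, `Ψ = psiLatticeMatrix b hψΛ`)

* §1 `mem_fixedPoints_cokernel_iff` (`q ∈ K(ψ)^Γ` iff `γ • q = q` for all `γ ∈ Γ`), `zero_mem_fixedPoints_cokernel`;
  ★ `kernelZeroSection htf hψΛ` — **the identity section `[J] ↦ [(J, 0)]`** of the kernel system (for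
  every `Γ`: `_mk`, `polarizationKernelSystemProj_kernelZeroSection`, `continuous_kernelZeroSection`).
* §2 (`X⁺` preconnected, nonempty) ★★ `continuousSectionsPolarizationKernelEquivFixed` — **`H⁰(Γ\X⁺, K) ≃
  K(ψ)^Γ`**; ★ `exists_kernelSection_through_iff` — a class `q` extends to a horizontal section through
  `[(J₀, q)]` iff it is `Γ`-invariant; `finite_continuousSections_polarizationKernel'`; ★★
  `natCard_continuousSections_polarizationKernel_le` — **at most `|det Ψ| = deg φ_L` horizontal sections**;
  ★★ `natCard_continuousSections_polarizationKernel_eq_iff` — **exactly `|det Ψ|` iff `Γ` acts trivially on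
  `K(ψ)`** (a full level structure on the kernel of the polarization), and its two directions
  `cokernelMap_eq_self_of_natCard_eq`, `one_le_natCard_continuousSections_polarizationKernel`.

Definitions with bodies, theorems; no `sorry`; no named facts; no instances (`letI`); no notation.

## References

* [VoisinHodgeII2003] C. Voisin, *Hodge Theory and Complex Algebraic Geometry II*, CUP 2003, §3.1.1
  Prop. 3.9, Cor. 3.10, (3.1).
* [Deligne1982HodgeCycles] P. Deligne, *Hodge cycles on abelian varieties*, in LNM 900, Springer 1982,
  proof of Thm. 4.8, p. 50.
* [Lange2023AbelianVarietiesComplex] H. Lange, *Abelian Varieties over the Complex Numbers*, Springer 2023,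
  §1.4.2 (1.14), Prop. 1.4.7.
-/

noncomputable section

open MulAction Function Set
open scoped Matrix
open Literature.Topology.CoveringSpaces Literature.Topology.CoveringSpaces.AssocCovering

namespace Literature.LinearAlgebra.QuadraticForm

namespace arithmeticGroup

variable {V : Type*} [NormedAddCommGroup V] [NormedSpace ℝ V]
variable {k : V →L[ℝ] V} {ψ : LinearMap.BilinForm ℝ V} {Λ : Submodule ℤ V}
variable {G : Subgroup (arithmeticGroup k ψ Λ)}

/-! ### §1 Invariant classes and the zero section -/

/-- `q ∈ K(ψ)^Γ` iff `[ρ^∨(γ) f] = [f]` for all `γ ∈ Γ` (`q = [f]`). [cite: VoisinHodgeII2003, §3.1.1 (3.1)] -/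
theorem mem_fixedPoints_cokernel_iff (hψΛ : ∀ x ∈ Λ, ∀ y ∈ Λ, ∃ m : ℤ, ψ x y = m)
    (q : Module.Dual ℤ Λ ⧸ LinearMap.range (psiLattice hψΛ)) :
    (letI := cokernelAction k ψ Λ hψΛ;
      q ∈ fixedPoints G (Module.Dual ℤ Λ ⧸ LinearMap.range (psiLattice hψΛ))) ↔
      ∀ γ : G, cokernelMap hψΛ (γ : arithmeticGroup k ψ Λ) q = q :=
  Iff.rfl

/-- The zero class is `Γ`-invariant (`γ` acts linearly on `K(ψ)`). [cite: VoisinHodgeII2003, §3.1.1 (3.1)] -/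
theorem zero_mem_fixedPoints_cokernel (hψΛ : ∀ x ∈ Λ, ∀ y ∈ Λ, ∃ m : ℤ, ψ x y = m) :
    (letI := cokernelAction k ψ Λ hψΛ;
      (0 : Module.Dual ℤ Λ ⧸ LinearMap.range (psiLattice hψΛ)) ∈
        fixedPoints G (Module.Dual ℤ Λ ⧸ LinearMap.range (psiLattice hψΛ))) :=
  fun γ ↦ map_zero (cokernelMap hψΛ (γ : arithmeticGroup k ψ Λ))

section TorsionFree

variable [FiniteDimensional ℝ V] [DiscreteTopology Λ] [IsZLattice ℝ Λ]
  (htf : ∀ g : G, IsOfFinOrder g → g = 1)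

/-- ★ **The zero (identity) section `[J] ↦ [(J, 0)]` of the kernel system `Γ\(X⁺ × K(ψ))`** — it exists
for every `Γ` (the unit of the kernel group of the polarizations of the fibres).
[cite: VoisinHodgeII2003, §3.1.1 (3.1)] [cite: Deligne1982HodgeCycles, proof of Thm. 4.8, p. 50] -/
def kernelZeroSection (hψΛ : ∀ x ∈ Λ, ∀ y ∈ Λ, ∃ m : ℤ, ψ x y = m) :
    Quotient (orbitRel G (posComplexStructures k ψ)) → PolarizationKernelSystem G hψΛ :=
  letI : TopologicalSpace (Module.Dual ℤ Λ ⧸ LinearMap.range (psiLattice hψΛ)) := ⊥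
  letI := cokernelAction k ψ Λ hψΛ
  flatSection (isQuotientCoveringMap_of_torsionFree G htf) ⟨0, zero_mem_fixedPoints_cokernel hψΛ⟩

/-- Its value on `[J]`: `[(J, 0)]`. [cite: VoisinHodgeII2003, §3.1.1 (3.1)] -/
@[simp] theorem kernelZeroSection_mk (hψΛ : ∀ x ∈ Λ, ∀ y ∈ Λ, ∃ m : ℤ, ψ x y = m)
    (J : posComplexStructures k ψ) :
    kernelZeroSection htf hψΛ (Quotient.mk _ J) = polarizationKernelSystemMk G hψΛ (J, 0) :=
  letI : TopologicalSpace (Module.Dual ℤ Λ ⧸ LinearMap.range (psiLattice hψΛ)) := ⊥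
  letI := cokernelAction k ψ Λ hψΛ
  flatSection_apply (isQuotientCoveringMap_of_torsionFree G htf) _ J

/-- It is a section of the projection. [cite: VoisinHodgeII2003, §3.1.1 (3.1)] -/
@[simp] theorem polarizationKernelSystemProj_kernelZeroSection (hψΛ : ∀ x ∈ Λ, ∀ y ∈ Λ, ∃ m : ℤ, ψ x y = m)
    (x : Quotient (orbitRel G (posComplexStructures k ψ))) :
    polarizationKernelSystemProj htf hψΛ (kernelZeroSection htf hψΛ x) = x :=
  letI : TopologicalSpace (Module.Dual ℤ Λ ⧸ LinearMap.range (psiLattice hψΛ)) := ⊥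
  letI := cokernelAction k ψ Λ hψΛ
  assocProj_flatSection (isQuotientCoveringMap_of_torsionFree G htf) _ x

/-- It is continuous. [cite: VoisinHodgeII2003, §3.1.1 (3.1)] -/
theorem continuous_kernelZeroSection (hψΛ : ∀ x ∈ Λ, ∀ y ∈ Λ, ∃ m : ℤ, ψ x y = m) :
    letI : TopologicalSpace (Module.Dual ℤ Λ ⧸ LinearMap.range (psiLattice hψΛ)) := ⊥
    Continuous (kernelZeroSection htf hψΛ) := by
  letI : TopologicalSpace (Module.Dual ℤ Λ ⧸ LinearMap.range (psiLattice hψΛ)) := ⊥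
  haveI : DiscreteTopology (Module.Dual ℤ Λ ⧸ LinearMap.range (psiLattice hψΛ)) := ⟨rfl⟩
  letI := cokernelAction k ψ Λ hψΛ
  exact continuous_flatSection (isQuotientCoveringMap_of_torsionFree G htf) _

/-! ### §2 `H⁰(Γ\X⁺, Γ\(X⁺ × K(ψ))) ≃ K(ψ)^Γ`: at most `|det Ψ|` horizontal sections -/

/-- ★★ **`H⁰(Γ\X⁺, K) ≃ K(ψ)^Γ`: the continuous global sections of the kernel system are the flat sections
through the `Γ`-invariant classes** (`X⁺` preconnected and nonempty — e.g. Deligne's hermitian symmetric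
`X⁺`). [cite: VoisinHodgeII2003, §3.1.1 Cor. 3.10, (3.1)] [cite: Deligne1982HodgeCycles, proof of Thm. 4.8, p. 50] -/
def continuousSectionsPolarizationKernelEquivFixed [PreconnectedSpace (posComplexStructures k ψ)]
    [Nonempty (posComplexStructures k ψ)] (hψΛ : ∀ x ∈ Λ, ∀ y ∈ Λ, ∃ m : ℤ, ψ x y = m) :
    letI : TopologicalSpace (Module.Dual ℤ Λ ⧸ LinearMap.range (psiLattice hψΛ)) := ⊥
    {s : Quotient (orbitRel G (posComplexStructures k ψ)) → PolarizationKernelSystem G hψΛ //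
        (∀ x, polarizationKernelSystemProj htf hψΛ (s x) = x) ∧ Continuous s} ≃
      {q : Module.Dual ℤ Λ ⧸ LinearMap.range (psiLattice hψΛ) //
        ∀ γ : G, cokernelMap hψΛ (γ : arithmeticGroup k ψ Λ) q = q} :=
  letI : TopologicalSpace (Module.Dual ℤ Λ ⧸ LinearMap.range (psiLattice hψΛ)) := ⊥
  haveI : DiscreteTopology (Module.Dual ℤ Λ ⧸ LinearMap.range (psiLattice hψΛ)) := ⟨rfl⟩
  letI := cokernelAction k ψ Λ hψΛ
  (continuousSectionEquivFixedPoints (isQuotientCoveringMap_of_torsionFree G htf)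
      (S := Module.Dual ℤ Λ ⧸ LinearMap.range (psiLattice hψΛ))).trans
    (Equiv.subtypeEquivRight fun q ↦ mem_fixedPoints_cokernel_iff hψΛ q)

/-- ★ **A class `q ∈ K(ψ)` extends to a horizontal section through `[(J₀, q)]` iff it is `Γ`-invariant**
(`X⁺` preconnected). [cite: VoisinHodgeII2003, §3.1.1 (3.1)] [cite: Deligne1982HodgeCycles, proof of Thm. 4.8, p. 50] -/
theorem exists_kernelSection_through_iff [PreconnectedSpace (posComplexStructures k ψ)]
    (hψΛ : ∀ x ∈ Λ, ∀ y ∈ Λ, ∃ m : ℤ, ψ x y = m) (J₀ : posComplexStructures k ψ)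
    (q : Module.Dual ℤ Λ ⧸ LinearMap.range (psiLattice hψΛ)) :
    letI : TopologicalSpace (Module.Dual ℤ Λ ⧸ LinearMap.range (psiLattice hψΛ)) := ⊥
    (∃ s : Quotient (orbitRel G (posComplexStructures k ψ)) → PolarizationKernelSystem G hψΛ,
        (∀ x, polarizationKernelSystemProj htf hψΛ (s x) = x) ∧ Continuous s ∧
          s (Quotient.mk _ J₀) = polarizationKernelSystemMk G hψΛ (J₀, q)) ↔
      ∀ γ : G, cokernelMap hψΛ (γ : arithmeticGroup k ψ Λ) q = q := by
  letI : TopologicalSpace (Module.Dual ℤ Λ ⧸ LinearMap.range (psiLattice hψΛ)) := ⊥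
  haveI : DiscreteTopology (Module.Dual ℤ Λ ⧸ LinearMap.range (psiLattice hψΛ)) := ⟨rfl⟩
  letI := cokernelAction k ψ Λ hψΛ
  exact exists_section_through_iff (isQuotientCoveringMap_of_torsionFree G htf) J₀ q

/-- ★ **`H⁰` of the kernel system is finite** (`K(ψ)` is finite for non-degenerate `ψ`).
[cite: Lange2023AbelianVarietiesComplex, §1.4.2 Prop. 1.4.7] [cite: VoisinHodgeII2003, §3.1.1 Cor. 3.10] -/
theorem finite_continuousSections_polarizationKernel' [PreconnectedSpace (posComplexStructures k ψ)]
    [Nonempty (posComplexStructures k ψ)] (hnd : ψ.Nondegenerate)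
    (hψΛ : ∀ x ∈ Λ, ∀ y ∈ Λ, ∃ m : ℤ, ψ x y = m) :
    letI : TopologicalSpace (Module.Dual ℤ Λ ⧸ LinearMap.range (psiLattice hψΛ)) := ⊥
    Finite {s : Quotient (orbitRel G (posComplexStructures k ψ)) → PolarizationKernelSystem G hψΛ //
        (∀ x, polarizationKernelSystemProj htf hψΛ (s x) = x) ∧ Continuous s} := by
  haveI := finite_dualQuotientRange hnd hψΛ
  exact Finite.of_equiv _ (continuousSectionsPolarizationKernelEquivFixed htf hψΛ).symm

variable {ι : Type*} [Fintype ι] [DecidableEq ι]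

/-- ★★ **At most `|det Ψ| = deg φ_L` horizontal sections**: `#H⁰(Γ\X⁺, K) ≤ #K(ψ) = |det Ψ|`.
[cite: Lange2023AbelianVarietiesComplex, §1.4.2 Prop. 1.4.7] [cite: VoisinHodgeII2003, §3.1.1 Cor. 3.10] -/
theorem natCard_continuousSections_polarizationKernel_le [PreconnectedSpace (posComplexStructures k ψ)]
    [Nonempty (posComplexStructures k ψ)] (b : Module.Basis ι ℤ Λ) (hnd : ψ.Nondegenerate)
    (hψΛ : ∀ x ∈ Λ, ∀ y ∈ Λ, ∃ m : ℤ, ψ x y = m) :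
    letI : TopologicalSpace (Module.Dual ℤ Λ ⧸ LinearMap.range (psiLattice hψΛ)) := ⊥
    Nat.card {s : Quotient (orbitRel G (posComplexStructures k ψ)) → PolarizationKernelSystem G hψΛ //
        (∀ x, polarizationKernelSystemProj htf hψΛ (s x) = x) ∧ Continuous s} ≤
      (psiLatticeMatrix b hψΛ).det.natAbs := by
  haveI := finite_dualQuotientRange hnd hψΛ
  rw [Nat.card_congr (continuousSectionsPolarizationKernelEquivFixed htf hψΛ),
    ← natCard_dualQuotientRange_eq_natAbs_det b hnd hψΛ]
  exact Finite.card_subtype_le _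

/-- ★★ **Exactly `|det Ψ|` horizontal sections iff `Γ` acts trivially on `K(ψ)`** — a full level structure
on the kernel of the polarization (e.g. `Γ ≤ Γ(N)`, `|det Ψ| ∣ N`). [cite: VoisinHodgeII2003, §3.1.1 Prop. 3.9, Cor. 3.10]
[cite: Deligne1982HodgeCycles, proof of Thm. 4.8, p. 50] [cite: Lange2023AbelianVarietiesComplex, §1.4.2 Prop. 1.4.7] -/
theorem natCard_continuousSections_polarizationKernel_eq_iff [PreconnectedSpace (posComplexStructures k ψ)]
    [Nonempty (posComplexStructures k ψ)] (b : Module.Basis ι ℤ Λ) (hnd : ψ.Nondegenerate)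
    (hψΛ : ∀ x ∈ Λ, ∀ y ∈ Λ, ∃ m : ℤ, ψ x y = m) :
    letI : TopologicalSpace (Module.Dual ℤ Λ ⧸ LinearMap.range (psiLattice hψΛ)) := ⊥
    Nat.card {s : Quotient (orbitRel G (posComplexStructures k ψ)) → PolarizationKernelSystem G hψΛ //
        (∀ x, polarizationKernelSystemProj htf hψΛ (s x) = x) ∧ Continuous s} =
      (psiLatticeMatrix b hψΛ).det.natAbs ↔
      ∀ (γ : G) (q : Module.Dual ℤ Λ ⧸ LinearMap.range (psiLattice hψΛ)),
        cokernelMap hψΛ (γ : arithmeticGroup k ψ Λ) q = q := by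
  haveI := finite_dualQuotientRange hnd hψΛ
  rw [Nat.card_congr (continuousSectionsPolarizationKernelEquivFixed htf hψΛ),
    ← natCard_dualQuotientRange_eq_natAbs_det b hnd hψΛ]
  constructor
  · intro h γ q
    by_contra hq
    have hlt := Finite.card_subtype_lt
      (p := fun q : Module.Dual ℤ Λ ⧸ LinearMap.range (psiLattice hψΛ) ↦
        ∀ γ : G, cokernelMap hψΛ (γ : arithmeticGroup k ψ Λ) q = q) (x := q) (fun h' ↦ hq (h' γ))
    exact hlt.ne h
  · intro h
    exact Nat.card_congr (Equiv.subtypeUnivEquiv fun q γ ↦ h γ q)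

/-- The converse direction as a statement on the action: **if the kernel system has `|det Ψ|` horizontal
sections then `Γ` acts trivially on `K(ψ)`.** [cite: VoisinHodgeII2003, §3.1.1 Prop. 3.9] -/
theorem cokernelMap_eq_self_of_natCard_eq [PreconnectedSpace (posComplexStructures k ψ)]
    [Nonempty (posComplexStructures k ψ)] (b : Module.Basis ι ℤ Λ) (hnd : ψ.Nondegenerate)
    (hψΛ : ∀ x ∈ Λ, ∀ y ∈ Λ, ∃ m : ℤ, ψ x y = m)
    (h : letI : TopologicalSpace (Module.Dual ℤ Λ ⧸ LinearMap.range (psiLattice hψΛ)) := ⊥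
      Nat.card {s : Quotient (orbitRel G (posComplexStructures k ψ)) → PolarizationKernelSystem G hψΛ //
        (∀ x, polarizationKernelSystemProj htf hψΛ (s x) = x) ∧ Continuous s} =
      (psiLatticeMatrix b hψΛ).det.natAbs) (γ : G) (q : Module.Dual ℤ Λ ⧸ LinearMap.range (psiLattice hψΛ)) :
    cokernelMap hψΛ (γ : arithmeticGroup k ψ Λ) q = q :=
  (natCard_continuousSections_polarizationKernel_eq_iff htf b hnd hψΛ).1 h γ q

/-- **There is always at least one horizontal section** (the zero section): `1 ≤ #H⁰`.
[cite: VoisinHodgeII2003, §3.1.1 (3.1)] -/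
theorem one_le_natCard_continuousSections_polarizationKernel [PreconnectedSpace (posComplexStructures k ψ)]
    [Nonempty (posComplexStructures k ψ)] (hnd : ψ.Nondegenerate)
    (hψΛ : ∀ x ∈ Λ, ∀ y ∈ Λ, ∃ m : ℤ, ψ x y = m) :
    letI : TopologicalSpace (Module.Dual ℤ Λ ⧸ LinearMap.range (psiLattice hψΛ)) := ⊥
    1 ≤ Nat.card {s : Quotient (orbitRel G (posComplexStructures k ψ)) → PolarizationKernelSystem G hψΛ //
        (∀ x, polarizationKernelSystemProj htf hψΛ (s x) = x) ∧ Continuous s} := by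
  letI : TopologicalSpace (Module.Dual ℤ Λ ⧸ LinearMap.range (psiLattice hψΛ)) := ⊥
  haveI := finite_continuousSections_polarizationKernel' htf hnd hψΛ (G := G)
  rw [Nat.one_le_iff_ne_zero, Nat.card_ne_zero]
  exact ⟨⟨⟨kernelZeroSection htf hψΛ, fun x ↦ polarizationKernelSystemProj_kernelZeroSection htf hψΛ x,
    continuous_kernelZeroSection htf hψΛ⟩⟩, inferInstance⟩

end TorsionFree

end arithmeticGroup

end Literature.LinearAlgebra.QuadraticForm
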